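import Summits.ValiantsHypothesis.ValiantsHypothesis.Theorems.AnyonJetsJetConstantElimPaddingPlumbing
import Literature.Computability.AlgebraicComplexity.ConstantFreeValiant
import Mathlib.Data.List.GetD
import HarnessLib

/-!
# AnyonJets — crux `JetConstantElimTwoAdic` (stmt-ValiantsHypothesis-23655), stub
# `∃ b₁, IntegralMultipleTwoAdicWith b₁`: padding homogenisation AT THE FORMAL DEGREE

Route-independent (no `Theses` import, no definitions, no `sorry`). The padding pass of
`…PaddingHomogenisation.lean` re-computes gate `j` of a sign-constant circuit at the uniform
exponent `2^(j+1)`, whence the multiplier `N^(2^(3 size Q))` of the denominator-clearing lemma —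
of exponential 2-adic depth when `N` is even ("towers of `1/2`", the residual of the multiplier
bypass). Here the SAME pass is run at the exact FORMAL DEGREE of each gate (tree
`ArithCircuit.formalDegree`, Bürgisser 2009 §2.2: leaves `1`, sums `max`, products `+`):

* `fpad_operand`, `fpad_main`, `exists_fpadded_circuit` — for a fan-in-two sign-constant circuit
  `Γ` over `ℤ` of size `S` and a weight `w ≤ 1`, a fan-in-two sign-constant circuit `Γ'` over
  `Option ι` of size `≤ 4 (S+1)²` with `κ_w(Γ'.eval) = z^(formalDegree Γ) · Γ.eval`.

So denominators are cleared by the multiplier `N^(formalDegree)` instead of `N^(2^S)`: its 2-adic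
depth is `formalDegree · v₂(N)`, polynomial for circuits of polynomial formal degree — the
formal-degree slice of the stub (`…IntegralMultipleTwoAdicFormalDegree.lean`). Honest framing:
bookkeeping; VP ≠ VNP is NOT proved here.

References: P. Bürgisser, *On defining integers …*, Comput. Complexity 18 (2009), §2.2 (formal
degree); V. Strassen, *Vermeidung von Divisionen* (1973).
-/

noncomputable section

-- single-conjunct layout: Sub = Summit, duplicated namespace component intended
set_option linter.dupNamespace false

namespace Summit.ValiantsHypothesis.ValiantsHypothesis.Theorems.AnyonJets.JetConstantElim

open MvPolynomial Literature.Computability.AlgebraicComplexity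
open Literature.Computability.AlgebraicComplexity.ArithCircuit

section FormalDegreePadding

variable {ι : Type*}

/-- An operand of `Γ` read at stage `j` is made available at exponent EQUAL TO ITS FORMAL DEGREE
(`1` for leaves — lift a variable of weight `w i ≤ 1` by `1 - w i`, a constant by `1`; a backward
reference carries the formal degree of its gate by the invariant; a junk reference has value
`0`). [cite: Burgisser2006, §2.2] -/
theorem fpad_operand (w : ι → ℕ) (hw : ∀ i, w i ≤ 1) {S j : ℕ}
    (vals : List (MvPolynomial ι ℤ)) (hvals : vals.length = j) (degs : List ℕ)
    {gs : List (Gate ℤ (Option ι))} (hg : ∀ g ∈ gs, g.fanIn ≤ 2 ∧ g.HasSignConstants)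
    (hZ : ∀ t ≤ S, ∃ u : Operand ℤ (Option ι), u.RefsBelow gs.length ∧ u.HasSignConstants ∧
      u.eval (gateValues gs) = X none ^ 2 ^ t)
    (hInv : ∀ i < j, ∃ H : MvPolynomial (Option ι) ℤ,
      (∃ u : Operand ℤ (Option ι), u.RefsBelow gs.length ∧ u.HasSignConstants ∧
        u.eval (gateValues gs) = H) ∧
      aeval (fun o : Option ι => Option.elim o (X none) (fun i => X (some i) * X none ^ w i)) H =
        X none ^ degs.getD i 1 * rename some (vals.getD i 0))
    (u : Operand ℤ ι) (hu : u.HasSignConstants) :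
    ∃ gs' : List (Gate ℤ (Option ι)), gs <+: gs' ∧
      (∀ g ∈ gs', g.fanIn ≤ 2 ∧ g.HasSignConstants) ∧ gs'.length ≤ gs.length + (S + 1) ∧
      ∃ H : MvPolynomial (Option ι) ℤ,
        (∃ u : Operand ℤ (Option ι), u.RefsBelow gs'.length ∧ u.HasSignConstants ∧
          u.eval (gateValues gs') = H) ∧
        aeval (fun o : Option ι => Option.elim o (X none) (fun i => X (some i) * X none ^ w i)) H =
          X none ^ u.formalDegree degs * rename some (u.eval vals) := by
  have h2S : (1 : ℕ) < 2 ^ (S + 1) := Nat.one_lt_two_pow (by omega)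
  cases u with
  | var i =>
    have h0 : aeval (fun o : Option ι => Option.elim o (X none) (fun i => X (some i) * X none ^ w i))
        (X (some i) : MvPolynomial (Option ι) ℤ) =
          X none ^ w i * rename some (X i : MvPolynomial ι ℤ) := by
      rw [aeval_X, rename_X]
      simp only [Option.elim]
      ring
    obtain ⟨gs', hpre, hg', hlen, H, hH, hκ⟩ := pad_lift w S (1 - w i) (by omega) gs hg hZ
      (X (some i)) (rename some (X i : MvPolynomial ι ℤ)) (w i) (sc_avail_X gs (some i)) h0
    refine ⟨gs', hpre, hg', hlen, H, hH, ?_⟩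
    rw [hκ, Nat.add_sub_cancel' (hw i)]
    rfl
  | const c =>
    have h0 : aeval (fun o : Option ι => Option.elim o (X none) (fun i => X (some i) * X none ^ w i))
        (C c : MvPolynomial (Option ι) ℤ) = X none ^ 0 * rename some (C c : MvPolynomial ι ℤ) := by
      rw [aeval_C, rename_C, pow_zero, one_mul, MvPolynomial.algebraMap_eq]
    obtain ⟨gs', hpre, hg', hlen, H, hH, hκ⟩ := pad_lift w S 1 h2S gs hg hZ
      (C c) (rename some (C c : MvPolynomial ι ℤ)) 0 (sc_avail_C gs hu) h0
    refine ⟨gs', hpre, hg', hlen, H, hH, ?_⟩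
    rw [hκ, Nat.zero_add]
    rfl
  | gate i =>
    rcases Nat.lt_or_ge i j with hij | hji
    · obtain ⟨H₀, hH₀, hκ₀⟩ := hInv i hij
      exact ⟨gs, List.prefix_rfl, hg, by omega, H₀, hH₀, hκ₀⟩
    · have hval : (Operand.gate i : Operand ℤ ι).eval vals = 0 := by
        simp [Operand.eval, List.getD_eq_getElem?_getD, List.getElem?_eq_none (hvals ▸ hji)]
      refine ⟨gs, List.prefix_rfl, hg, by omega, C 0, sc_avail_C gs isSignConstant_zero, ?_⟩
      rw [hval]
      simp

/-- **The formal-degree padding pass.** For every `j ≤ S = size Γ` there is a fan-in-two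
sign-constant gate list of length `≤ S + j (4S + 5)` in which all `z^(2^t)`, `t ≤ S`, are
available and, for each `i < j`, some `H_i` with `κ_w(H_i) = z^(fdeg i) · (value of gate i)`,
where `fdeg i ≤ 2^(i+1)` is the formal degree of gate `i`. [cite: Burgisser2006, §2.2] -/
theorem fpad_main (w : ι → ℕ) (hw : ∀ i, w i ≤ 1) (Γ : ArithCircuit ℤ ι) (h2 : Γ.IsFanInTwo)
    (hs : Γ.HasSignConstants) :
    ∀ j ≤ Γ.size, ∃ gs : List (Gate ℤ (Option ι)),
      (∀ g ∈ gs, g.fanIn ≤ 2 ∧ g.HasSignConstants) ∧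
      gs.length ≤ Γ.size + j * (4 * Γ.size + 5) ∧
      (∀ t ≤ Γ.size, ∃ u : Operand ℤ (Option ι), u.RefsBelow gs.length ∧ u.HasSignConstants ∧
        u.eval (gateValues gs) = X none ^ 2 ^ t) ∧
      ∀ i < j, (gateFormalDegrees (Γ.gates.take j)).getD i 1 ≤ 2 ^ (i + 1) ∧
        ∃ H : MvPolynomial (Option ι) ℤ,
        (∃ u : Operand ℤ (Option ι), u.RefsBelow gs.length ∧ u.HasSignConstants ∧
          u.eval (gateValues gs) = H) ∧
        aeval (fun o : Option ι => Option.elim o (X none) (fun i => X (some i) * X none ^ w i)) H =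
          X none ^ (gateFormalDegrees (Γ.gates.take j)).getD i 1 *
            rename some ((gateValues (Γ.gates.take j)).getD i 0) := by
  intro j
  induction j with
  | zero =>
    intro _
    obtain ⟨gs, -, hg, hlen, hZ⟩ := pad_powers ([] : List (Gate ℤ (Option ι))) (by simp) Γ.size
    exact ⟨gs, hg, by simpa using hlen, hZ, fun i hi => absurd hi (Nat.not_lt_zero _)⟩
  | succ j ih =>
    intro hj1
    obtain ⟨gs, hg, hlen, hZ, hInv⟩ := ih (Nat.le_of_succ_le hj1)
    have hjlt : j < Γ.gates.length := hj1
    set S := Γ.size with hS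
    have hvals : (gateValues (Γ.gates.take j)).length = j := by
      rw [gateValues_length, List.length_take, Nat.min_eq_left hjlt.le]
    have hdegs : (gateFormalDegrees (Γ.gates.take j)).length = j := by
      rw [gateFormalDegrees_length, List.length_take, Nat.min_eq_left hjlt.le]
    have hgmem : Γ.gates[j] ∈ Γ.gates := List.getElem_mem hjlt
    have hg2 : (Γ.gates[j]).fanIn ≤ 2 := h2 _ hgmem
    have hgs : (Γ.gates[j]).HasSignConstants := hs.1 _ hgmem
    have htake : gateValues (Γ.gates.take (j + 1)) =
        gateValues (Γ.gates.take j) ++ [(Γ.gates[j]).eval (gateValues (Γ.gates.take j))] := by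
      rw [List.take_succ_eq_append_getElem hjlt]
      exact gateValues_append_singleton _ _
    have htakeD : gateFormalDegrees (Γ.gates.take (j + 1)) =
        gateFormalDegrees (Γ.gates.take j) ++
          [(Γ.gates[j]).formalDegree (gateFormalDegrees (Γ.gates.take j))] := by
      rw [List.take_succ_eq_append_getElem hjlt]
      exact gateFormalDegrees_append_singleton _ _
    generalize hg_def : Γ.gates[j] = g at hgmem hg2 hgs htake htakeD
    generalize hvals_def : gateValues (Γ.gates.take j) = vals at hvals hInv htake htakeD
    generalize hdegs_def : gateFormalDegrees (Γ.gates.take j) = degs at hdegs hInv htakeD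
    -- formal degrees of operands at stage `j` are `≤ 2^j`
    have hopdeg : ∀ u : Operand ℤ ι, u.formalDegree degs ≤ 2 ^ j := by
      intro u
      cases u with
      | var i => exact Nat.one_le_two_pow
      | const c => exact Nat.one_le_two_pow
      | gate i =>
        simp only [Operand.formalDegree]
        rcases Nat.lt_or_ge i j with hij | hji
        · exact ((hInv i hij).1).trans (Nat.pow_le_pow_right (by norm_num) hij)
        · rw [List.getD_eq_default _ _ (by rw [hdegs]; exact hji)]
          exact Nat.one_le_two_pow
    have h2j : 2 ^ j ≤ 2 ^ S := Nat.pow_le_pow_right (by norm_num) (by omega)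
    have h2S : 2 ^ S < 2 ^ (S + 1) := Nat.pow_lt_pow_right (by norm_num) (by omega)
    -- it suffices to treat the new gate
    suffices hnew : g.formalDegree degs ≤ 2 ^ (j + 1) ∧
        ∃ gs' : List (Gate ℤ (Option ι)), gs <+: gs' ∧
        (∀ g ∈ gs', g.fanIn ≤ 2 ∧ g.HasSignConstants) ∧ gs'.length ≤ gs.length + (4 * S + 5) ∧
        ∃ H : MvPolynomial (Option ι) ℤ,
          (∃ u : Operand ℤ (Option ι), u.RefsBelow gs'.length ∧ u.HasSignConstants ∧
            u.eval (gateValues gs') = H) ∧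
          aeval (fun o : Option ι => Option.elim o (X none) (fun i => X (some i) * X none ^ w i)) H =
            X none ^ g.formalDegree degs * rename some (g.eval vals) by
      obtain ⟨hdeg, gs', hpre, hg', hlen', H, hH, hκ⟩ := hnew
      refine ⟨gs', hg', ?_, fun t ht => sc_avail_mono hpre (hZ t ht), fun i hi => ?_⟩
      · have hmul : (j + 1) * (4 * S + 5) = j * (4 * S + 5) + (4 * S + 5) := by ring
        rw [hmul]; omega
      · rw [htake, htakeD]
        rcases Nat.lt_or_ge i j with hij | hji
        · obtain ⟨hbd, H', hH', hκ'⟩ := hInv i hij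
          rw [List.getD_append _ _ _ _ (by rw [hdegs]; exact hij),
            List.getD_append _ _ _ _ (by rw [hvals]; exact hij)]
          exact ⟨hbd, H', sc_avail_mono hpre hH', hκ'⟩
        · obtain rfl : i = j := by omega
          rw [List.getD_append_right _ _ _ _ (by rw [hdegs]),
            List.getD_append_right _ _ _ _ (by rw [hvals])]
          simp only [hdegs, hvals, Nat.sub_self, List.getD_cons_zero]
          exact ⟨hdeg, H, hH, hκ⟩
    -- operands at their formal degree
    have hop : ∀ (gs₀ : List (Gate ℤ (Option ι))), gs <+: gs₀ →
        (∀ g ∈ gs₀, g.fanIn ≤ 2 ∧ g.HasSignConstants) →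
        ∀ (u : Operand ℤ ι), u.HasSignConstants →
        ∃ gs' : List (Gate ℤ (Option ι)), gs₀ <+: gs' ∧
          (∀ g ∈ gs', g.fanIn ≤ 2 ∧ g.HasSignConstants) ∧ gs'.length ≤ gs₀.length + (S + 1) ∧
          ∃ H : MvPolynomial (Option ι) ℤ,
            (∃ u : Operand ℤ (Option ι), u.RefsBelow gs'.length ∧ u.HasSignConstants ∧
              u.eval (gateValues gs') = H) ∧
            aeval (fun o : Option ι => Option.elim o (X none) (fun i => X (some i) * X none ^ w i))
              H = X none ^ u.formalDegree degs * rename some (u.eval vals) := by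
      intro gs₀ hpre₀ hg₀ u hu
      exact fpad_operand w hw (S := S) vals hvals degs hg₀
        (fun t ht => sc_avail_mono hpre₀ (hZ t ht))
        (fun i hi => by
          obtain ⟨-, H, hH, hκ⟩ := hInv i hi
          exact ⟨H, sc_avail_mono hpre₀ hH, hκ⟩) u hu
    have hZall : ∀ (gs₀ : List (Gate ℤ (Option ι))), gs <+: gs₀ →
        ∀ t ≤ S, ∃ u : Operand ℤ (Option ι), u.RefsBelow gs₀.length ∧ u.HasSignConstants ∧
          u.eval (gateValues gs₀) = X none ^ 2 ^ t :=
      fun gs₀ hpre₀ t ht => sc_avail_mono hpre₀ (hZ t ht)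
    cases g with
    | sum args =>
      rcases args with _ | ⟨⟨a, u⟩, _ | ⟨⟨b, v⟩, _ | ⟨c, rest⟩⟩⟩
      · -- `Σ ∅ = 0`, formal degree `0`
        refine ⟨Nat.zero_le _, gs, List.prefix_rfl, hg, by omega, C 0,
          sc_avail_C gs isSignConstant_zero, ?_⟩
        simp [Gate.eval, Gate.formalDegree]
      · -- `a • u`, formal degree `max (fdeg u) 0`
        have hau : IsSignConstant a ∧ u.HasSignConstants := hgs (a, u) (by simp)
        have hfd : (Gate.sum [(a, u)]).formalDegree degs = u.formalDegree degs := by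
          simp [Gate.formalDegree]
        obtain ⟨gs₁, hpre₁, hg₁, hlen₁, Hu, hHu, hκu⟩ := hop gs List.prefix_rfl hg u hau.2
        obtain ⟨gs₂, hpre₂, hg₂, hlen₂, hsum⟩ :=
          sc_extend_sum hg₁ hau.1 isSignConstant_zero hHu (sc_avail_C gs₁ isSignConstant_zero)
        refine ⟨by rw [hfd]; exact (hopdeg u).trans (Nat.pow_le_pow_right (by norm_num) (by omega)),
          gs₂, hpre₁.trans hpre₂, hg₂, by omega, _, hsum, ?_⟩
        have hge : Gate.eval vals (Gate.sum [(a, u)]) = a • u.eval vals := by simp [Gate.eval]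
        rw [hfd, hge, zero_smul, add_zero, map_smul, hκu, map_smul, mul_smul_comm]
      · -- `a • u + b • v`, formal degree `max (fdeg u) (max (fdeg v) 0)`
        have hau : IsSignConstant a ∧ u.HasSignConstants := hgs (a, u) (by simp)
        have hbv : IsSignConstant b ∧ v.HasSignConstants := hgs (b, v) (by simp)
        set T := (Gate.sum [(a, u), (b, v)]).formalDegree degs with hT
        have hTeq : T = max (u.formalDegree degs) (max (v.formalDegree degs) 0) := by
          simp [hT, Gate.formalDegree]
        have hTu : u.formalDegree degs ≤ T := by rw [hTeq]; exact le_max_left _ _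
        have hTv : v.formalDegree degs ≤ T := by
          rw [hTeq]; exact (le_max_left _ _).trans (le_max_right _ _)
        have hTle : T ≤ 2 ^ j := by
          rw [hTeq]; exact max_le (hopdeg u) (max_le (hopdeg v) (Nat.zero_le _))
        obtain ⟨gs₁, hpre₁, hg₁, hlen₁, Hu, hHu, hκu⟩ := hop gs List.prefix_rfl hg u hau.2
        obtain ⟨gs₂, hpre₂, hg₂, hlen₂, Hv, hHv, hκv⟩ := hop gs₁ hpre₁ hg₁ v hbv.2
        obtain ⟨gs₃, hpre₃, hg₃, hlen₃, Hu', hHu', hκu'⟩ := pad_lift w S (T - u.formalDegree degs)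
          (by omega) gs₂ hg₂ (hZall gs₂ (hpre₁.trans hpre₂)) Hu _ _ (sc_avail_mono hpre₂ hHu) hκu
        obtain ⟨gs₄, hpre₄, hg₄, hlen₄, Hv', hHv', hκv'⟩ := pad_lift w S (T - v.formalDegree degs)
          (by omega) gs₃ hg₃ (hZall gs₃ (hpre₁.trans (hpre₂.trans hpre₃))) Hv _ _
          (sc_avail_mono hpre₃ hHv) hκv
        rw [Nat.add_sub_cancel' hTu] at hκu'
        rw [Nat.add_sub_cancel' hTv] at hκv'
        obtain ⟨gs₅, hpre₅, hg₅, hlen₅, hsum⟩ :=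
          sc_extend_sum hg₄ hau.1 hbv.1 (sc_avail_mono hpre₄ hHu') hHv'
        refine ⟨hTle.trans (Nat.pow_le_pow_right (by norm_num) (by omega)), gs₅,
          hpre₁.trans (hpre₂.trans (hpre₃.trans (hpre₄.trans hpre₅))), hg₅, by omega, _, hsum, ?_⟩
        have hge : Gate.eval vals (Gate.sum [(a, u), (b, v)]) = a • u.eval vals + b • v.eval vals := by
          simp [Gate.eval]
        rw [hge]
        simp only [map_add, map_smul, hκu', hκv']
        rw [← mul_smul_comm, ← mul_smul_comm, ← mul_add]
      · exfalso
        simp [Gate.fanIn, Gate.args] at hg2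
    | prod args =>
      rcases args with _ | ⟨u, _ | ⟨v, _ | ⟨c, rest⟩⟩⟩
      · -- `Π ∅ = 1`, formal degree `0`
        refine ⟨Nat.zero_le _, gs, List.prefix_rfl, hg, by omega, C 1,
          sc_avail_C gs isSignConstant_one, ?_⟩
        simp [Gate.eval, Gate.formalDegree]
      · -- `Π [u] = u`, formal degree `fdeg u + 0`
        have hu : u.HasSignConstants := hgs u (by simp)
        have hfd : (Gate.prod [u]).formalDegree degs = u.formalDegree degs := by
          simp [Gate.formalDegree]
        obtain ⟨gs₁, hpre₁, hg₁, hlen₁, Hu, hHu, hκu⟩ := hop gs List.prefix_rfl hg u hu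
        refine ⟨by rw [hfd]; exact (hopdeg u).trans (Nat.pow_le_pow_right (by norm_num) (by omega)),
          gs₁, hpre₁, hg₁, by omega, Hu, hHu, ?_⟩
        rw [hκu, hfd]
        simp [Gate.eval]
      · -- `u * v`, formal degree `fdeg u + (fdeg v + 0)`
        have hu : u.HasSignConstants := hgs u (by simp)
        have hv : v.HasSignConstants := hgs v (by simp)
        have hfd : (Gate.prod [u, v]).formalDegree degs = u.formalDegree degs + v.formalDegree degs := by
          simp [Gate.formalDegree]
        obtain ⟨gs₁, hpre₁, hg₁, hlen₁, Hu, hHu, hκu⟩ := hop gs List.prefix_rfl hg u hu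
        obtain ⟨gs₂, hpre₂, hg₂, hlen₂, Hv, hHv, hκv⟩ := hop gs₁ hpre₁ hg₁ v hv
        obtain ⟨gs₃, hpre₃, hg₃, hlen₃, hprod⟩ := sc_extend_prod hg₂ (sc_avail_mono hpre₂ hHu) hHv
        refine ⟨?_, gs₃, hpre₁.trans (hpre₂.trans hpre₃), hg₃, by omega, Hu * Hv, hprod, ?_⟩
        · rw [hfd, pow_succ]
          have := hopdeg u; have := hopdeg v; omega
        · rw [map_mul, hκu, hκv, hfd, pow_add]
          simp [Gate.eval]
          ring
      · exfalso
        simp [Gate.fanIn, Gate.args] at hg2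

/-- **Padding homogenisation at the formal degree.** For a fan-in-two sign-constant circuit `Γ`
over `ℤ` of size `S` and a weight `w ≤ 1` there is a fan-in-two sign-constant circuit `Γ'`
over `Option ι` of size `≤ 4 (S+1)²` with `κ_w(Γ'.eval) = z^(formalDegree Γ) · Γ.eval`, and
`formalDegree Γ ≤ 2^S`. [cite: Burgisser2006, §2.2] -/
theorem exists_fpadded_circuit (w : ι → ℕ) (hw : ∀ i, w i ≤ 1) (Γ : ArithCircuit ℤ ι)
    (h2 : Γ.IsFanInTwo) (hs : Γ.HasSignConstants) :
    Γ.formalDegree ≤ 2 ^ Γ.size ∧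
    ∃ Γ' : ArithCircuit ℤ (Option ι), Γ'.IsFanInTwo ∧ Γ'.HasSignConstants ∧
      Γ'.size ≤ 4 * (Γ.size + 1) ^ 2 ∧
      aeval (fun o : Option ι => Option.elim o (X none) (fun i => X (some i) * X none ^ w i)) Γ'.eval =
        X none ^ Γ.formalDegree * rename some Γ.eval := by
  obtain ⟨gs, hg, hlen, hZ, hInv⟩ := fpad_main w hw Γ h2 hs Γ.size le_rfl
  rw [show Γ.gates.take Γ.size = Γ.gates from List.take_length] at hInv
  have hfdeg : Γ.formalDegree ≤ 2 ^ Γ.size := by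
    unfold ArithCircuit.formalDegree
    cases hout : Γ.output with
    | var i => exact Nat.one_le_two_pow
    | const c => exact Nat.one_le_two_pow
    | gate i =>
      simp only [Operand.formalDegree]
      rcases Nat.lt_or_ge i Γ.size with hi | hi
      · exact ((hInv i hi).1).trans (Nat.pow_le_pow_right (by norm_num) hi)
      · rw [List.getD_eq_default _ _ (by rw [gateFormalDegrees_length]; exact hi)]
        exact Nat.one_le_two_pow
  obtain ⟨gs', hpre, hg', hlen', H, ⟨u, hu, hus, huH⟩, hκ⟩ :=
    fpad_operand w hw (S := Γ.size) (gateValues Γ.gates) (gateValues_length _)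
      (gateFormalDegrees Γ.gates) hg hZ (fun i hi => (hInv i hi).2) Γ.output hs.2
  refine ⟨hfdeg, ⟨gs', u⟩, fun g hg'' => (hg' g hg'').1, ⟨fun g hg'' => (hg' g hg'').2, hus⟩, ?_, ?_⟩
  · change gs'.length ≤ 4 * (Γ.size + 1) ^ 2
    have hsq : Γ.size * (4 * Γ.size + 5) + 2 * Γ.size + 1 ≤ 4 * (Γ.size + 1) ^ 2 := by
      ring_nf; omega
    have hsz : Γ.size = Γ.gates.length := rfl
    omega
  · change aeval _ (u.eval (gateValues gs')) = _
    rw [huH, hκ]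
    rfl

end FormalDegreePadding

end Summit.ValiantsHypothesis.ValiantsHypothesis.Theorems.AnyonJets.JetConstantElim

end
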